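import Literature.AnabelianGeometry.AbsoluteAnabelian.AbsTopIProp410GraphSurjectivityProofs
import HarnessLib

/-!
# [AbsTopI] Prop 4.10 (iii): conj. 1 of `CoFreeCofinalImAlong` ⟺ the pulled-back X-kernels are
# OPEN in `Δ^tp_Y` — the residue is an openness clause on the tempered topology of `Y` (proof-only)

S. Mochizuki, *Topics in Absolute Anabelian Geometry I: Generalities* [AbsTopI] (2012), §0 p. 8 (the
`(Q, Δ)`-co-free completion `lim_H Im_Q(Π/H^{co-fr})`), Prop 4.10 (iii) p. 60, Def 4.11 (i)(c) p. 62
("a dense homomorphism"); manuscript pagination, lit key `paper:url-11ac98ba15fc`, read on the page.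

Context: node AbsTopI:Prop4.10(iii) of `HOME/plan/L4/SUBDAG-AbsTopI-Prop410.md`; the closers
`prop410iiiAt_of_geometric_residues` take, besides intrinsic residues of the two curves, conj. 1
`hleft` of `CoFreeCofinalImAlong`:
  `∀ H (X-index), ∃ H′ (Y-index), K_Y(H′) ≤ K_X(H)`  (kernels in `Q = Π̂_Y` of the §0 system),
certified NOT derivable from the intrinsic residues (`AbsTopIProp410TemperedModelSchemaNegative.lean`).
THIS FILE identifies WHAT conj. 1 says about the tempered topology: under André's basis clause (CF_Δ)
on `Δ^tp_Y` (and, for the forward direction, §0 p. 8's `hmin`),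

  conj. 1  ⟺  for every X-index `H`, the trace `toHat_Y⁻¹(K_X(H)) ∩ Δ^tp_Y` is OPEN in `Δ^tp_Y`

(`coFreeKernel_cofinal_left_iff_isOpen`).  "⇐" (`coFreeKernel_cofinal_left_of_isOpen`, no `hmin`):
the trace is an open NORMAL subgroup of `Δ^tp_Y`, so (CF_Δ) puts some `H′^{co-fr}` inside it, whence
`K_Y(H′) = cl·ncl(toHat_Y H′^{co-fr}) ≤ K_X(H)` (closed, normal).  "⇒": `K_Y(H′) ≤ K_X(H)` puts
`H′^{co-fr}` — open in `Δ^tp_Y` when it is the minimal co-free subgroup (`hmin`) — inside the trace.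
In particular conj. 1 follows from (CF_Δ) as soon as each `f(H^{co-fr})` is a neighbourhood of `1` in
`Δ^tp_Y` (`coFreeKernel_cofinal_left_of_image_mem_nhds`: e.g. `Δ^tp_X → Δ^tp_Y` an OPEN map and
`H^{co-fr}` open) — the shape of input an L3↔L4 bridge can supply; at the schema-negative datum
(profinite `Π^tp_Y`, infinite dual graph upstairs) the trace has infinite index, hence is not open.
Proof-only (no `def`/instance/named fact; FACT-LIST untouched).  Refereed prerequisite paper; nothing
here bears on [IUTchIII] Cor 3.12; typed ≠ proved.
-/

noncomputable section

open _root_.Topology Filter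

namespace Literature.AnabelianGeometry.AbsoluteAnabelian.AbsTopI.Prop410

open Literature.AnabelianGeometry.SemiGraphs
open Literature.AnabelianGeometry.AbsoluteAnabelian.AbsTopI

variable {p : ℕ} [Fact p.Prime]

namespace DeCuspidalization

variable {X Y : TemperedCurve p} (E : DeCuspidalization X Y)

/-- **conj. 1 from OPENNESS of the pulled-back kernels** (no `hmin`): if André's basis clause (CF_Δ)
holds on `Δ^tp_Y` and, for the X-index `H`, the trace `toHat_Y⁻¹(K_X(H)) ∩ Δ^tp_Y` is open in
`Δ^tp_Y`, then some Y-index `H′` has `K_Y(H′) ≤ K_X(H)`. [cite: MochizukiAbsTopI2012, §0 p.8] -/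
theorem coFreeKernel_cofinal_left_of_isOpen
    (hΔ : ∀ N : OpenNormalSubgroup Y.DeltaTemp, ∃ H' : CharOpenSubgroup Y.DeltaTemp,
      (cofreeCore H'.toSubgroup).subgroupOf Y.DeltaTemp ≤ N.toSubgroup)
    (H : CharOpenSubgroup X.DeltaTemp)
    (hopen : IsOpen ((((coFreeKernel (E.fHat.comp X.toHat) H.toSubgroup).comap
      Y.toHat.toMonoidHom).subgroupOf Y.DeltaTemp : Subgroup Y.DeltaTemp) : Set Y.DeltaTemp)) :
    ∃ H' : CharOpenSubgroup Y.DeltaTemp,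
      coFreeKernel ((ContinuousMonoidHom.id Y.PiHat).comp Y.toHat) H'.toSubgroup ≤
        coFreeKernel (E.fHat.comp X.toHat) H.toSubgroup := by
  set K : Subgroup Y.PiHat := coFreeKernel (E.fHat.comp X.toHat) H.toSubgroup with hK
  haveI : K.Normal := by rw [hK]; infer_instance
  haveI : (K.comap Y.toHat.toMonoidHom).Normal := Subgroup.Normal.comap inferInstance _
  -- the trace as an open normal subgroup of `Δ^tp_Y`
  let N : OpenNormalSubgroup Y.DeltaTemp :=
    { toSubgroup := (K.comap Y.toHat.toMonoidHom).subgroupOf Y.DeltaTemp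
      isOpen' := hopen
      isNormal' := inferInstance }
  obtain ⟨H', hH'⟩ := hΔ N
  refine ⟨H', ?_⟩
  refine Subgroup.topologicalClosure_minimal _ (Subgroup.normalClosure_le_normal ?_)
    (isClosed_coFreeKernel _ _)
  rintro _ ⟨y, hy, rfl⟩
  have hyΔ : y ∈ Y.DeltaTemp := H'.le (cofreeCore_le _ hy)
  have hyN : (⟨y, hyΔ⟩ : Y.DeltaTemp) ∈ N.toSubgroup := hH' (Subgroup.mem_subgroupOf.mpr hy)
  exact Subgroup.mem_subgroupOf.mp hyN

/-- **conj. 1 from (CF_Δ) and "`f(H^{co-fr})` is a neighbourhood of `1` in `Δ^tp_Y`"** — the openness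
is inherited by the trace `toHat_Y⁻¹(K_X(H)) ∩ Δ^tp_Y ⊇ f(H^{co-fr})` (a subgroup containing a
neighbourhood of `1` is open). [cite: MochizukiAbsTopI2012, §0 p.8] -/
theorem coFreeKernel_cofinal_left_of_image_mem_nhds
    (hΔ : ∀ N : OpenNormalSubgroup Y.DeltaTemp, ∃ H' : CharOpenSubgroup Y.DeltaTemp,
      (cofreeCore H'.toSubgroup).subgroupOf Y.DeltaTemp ≤ N.toSubgroup)
    (himg : ∀ H : CharOpenSubgroup X.DeltaTemp,
      (E.fDelta '' (((cofreeCore H.toSubgroup).subgroupOf X.DeltaTemp : Subgroup X.DeltaTemp) :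
        Set X.DeltaTemp)) ∈ 𝓝 (1 : Y.DeltaTemp)) :
    ∀ H : CharOpenSubgroup X.DeltaTemp, ∃ H' : CharOpenSubgroup Y.DeltaTemp,
      coFreeKernel ((ContinuousMonoidHom.id Y.PiHat).comp Y.toHat) H'.toSubgroup ≤
        coFreeKernel (E.fHat.comp X.toHat) H.toSubgroup := by
  intro H
  refine E.coFreeKernel_cofinal_left_of_isOpen hΔ H
    (Subgroup.isOpen_of_mem_nhds _ (g := (1 : Y.DeltaTemp)) ?_)
  refine Filter.mem_of_superset (himg H) ?_
  rintro _ ⟨x, hx, rfl⟩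
  rw [SetLike.mem_coe, Subgroup.mem_subgroupOf, Subgroup.mem_comap]
  change Y.toHat (E.f (x : X.PiTemp)) ∈ coFreeKernel (E.fHat.comp X.toHat) H.toSubgroup
  rw [E.toHat_comp]
  exact apply_mem_coFreeKernel (E.fHat.comp X.toHat) H.toSubgroup (Subgroup.mem_subgroupOf.mp hx)

/-- **Conversely, conj. 1 forces the traces to be open** when the Y-indices admit minimal co-free
subgroups (`hmin`, §0 p. 8): `K_Y(H′) ≤ K_X(H)` puts `H′^{co-fr}` — open in `H′`, `H′` open in
`Δ^tp_Y` — inside the trace. [cite: MochizukiAbsTopI2012, §0 p.8] -/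
theorem isOpen_of_coFreeKernel_cofinal_left
    (hmin : ∀ H' : CharOpenSubgroup Y.DeltaTemp, ∃ M, IsMinimalCofreeIn H'.toSubgroup M)
    (H : CharOpenSubgroup X.DeltaTemp) {H' : CharOpenSubgroup Y.DeltaTemp}
    (hle : coFreeKernel ((ContinuousMonoidHom.id Y.PiHat).comp Y.toHat) H'.toSubgroup ≤
        coFreeKernel (E.fHat.comp X.toHat) H.toSubgroup) :
    IsOpen ((((coFreeKernel (E.fHat.comp X.toHat) H.toSubgroup).comap
      Y.toHat.toMonoidHom).subgroupOf Y.DeltaTemp : Subgroup Y.DeltaTemp) : Set Y.DeltaTemp) := by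
  obtain ⟨M, hM⟩ := hmin H'
  obtain ⟨hMle, hN, hcf⟩ := hM.1
  have hCM : cofreeCore H'.toSubgroup = M := cofreeCore_eq_of_isMinimalCofreeIn hM
  -- `M ∩ Δ^tp_Y` is open in `Δ^tp_Y`: `M` is open in `H′`, and `H′` is open in `Δ^tp_Y`
  have hMopen : IsOpen ((M.subgroupOf Y.DeltaTemp : Subgroup Y.DeltaTemp) : Set Y.DeltaTemp) := by
    -- the inclusion `H′ ↪ Δ^tp_Y` is an open embedding
    let j : H'.toSubgroup → Y.DeltaTemp := fun h => ⟨h.1, H'.le h.2⟩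
    have hj : Topology.IsOpenEmbedding j := by
      refine ⟨?_, ?_⟩
      · refine Topology.IsEmbedding.of_comp (continuous_subtype_val.subtype_mk _)
          continuous_subtype_val ?_
        exact Topology.IsEmbedding.subtypeVal
      · have : Set.range j = ((H'.toSubgroup.subgroupOf Y.DeltaTemp : Subgroup Y.DeltaTemp) :
            Set Y.DeltaTemp) := by
          ext y
          constructor
          · rintro ⟨h, rfl⟩; exact Subgroup.mem_subgroupOf.mpr h.2
          · intro hy; exact ⟨⟨y.1, Subgroup.mem_subgroupOf.mp hy⟩, rfl⟩
        rw [this]; exact H'.isOpen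
    have heq : ((M.subgroupOf Y.DeltaTemp : Subgroup Y.DeltaTemp) : Set Y.DeltaTemp) =
        j '' ((M.subgroupOf H'.toSubgroup : Subgroup H'.toSubgroup) : Set H'.toSubgroup) := by
      ext y
      constructor
      · intro hy
        have hyM : (y : Y.PiTemp) ∈ M := Subgroup.mem_subgroupOf.mp hy
        exact ⟨⟨y.1, hMle hyM⟩, Subgroup.mem_subgroupOf.mpr hyM, rfl⟩
      · rintro ⟨h, hh, rfl⟩
        exact Subgroup.mem_subgroupOf.mpr (Subgroup.mem_subgroupOf.mp hh)
    rw [heq]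
    exact hj.isOpenMap _ hcf.isOpen
  refine Subgroup.isOpen_mono ?_ hMopen
  intro y hy
  have hyM : (y : Y.PiTemp) ∈ cofreeCore H'.toSubgroup := by rw [hCM]; exact Subgroup.mem_subgroupOf.mp hy
  rw [Subgroup.mem_subgroupOf, Subgroup.mem_comap]
  exact hle (apply_mem_coFreeKernel ((ContinuousMonoidHom.id Y.PiHat).comp Y.toHat) H'.toSubgroup hyM)

/-- **conj. 1 of `CoFreeCofinalImAlong` ⟺ openness of the traces `toHat_Y⁻¹(K_X(H)) ∩ Δ^tp_Y`**, under
(CF_Δ) and `hmin` on `Y`: the residue is a clause on the tempered topology of `Δ^tp_Y` RELATIVE to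
`X`. [cite: MochizukiAbsTopI2012, Prop 4.10 (iii) p.60] -/
theorem coFreeKernel_cofinal_left_iff_isOpen
    (hΔ : ∀ N : OpenNormalSubgroup Y.DeltaTemp, ∃ H' : CharOpenSubgroup Y.DeltaTemp,
      (cofreeCore H'.toSubgroup).subgroupOf Y.DeltaTemp ≤ N.toSubgroup)
    (hmin : ∀ H' : CharOpenSubgroup Y.DeltaTemp, ∃ M, IsMinimalCofreeIn H'.toSubgroup M) :
    (∀ H : CharOpenSubgroup X.DeltaTemp, ∃ H' : CharOpenSubgroup Y.DeltaTemp,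
      coFreeKernel ((ContinuousMonoidHom.id Y.PiHat).comp Y.toHat) H'.toSubgroup ≤
        coFreeKernel (E.fHat.comp X.toHat) H.toSubgroup) ↔
    ∀ H : CharOpenSubgroup X.DeltaTemp,
      IsOpen ((((coFreeKernel (E.fHat.comp X.toHat) H.toSubgroup).comap
        Y.toHat.toMonoidHom).subgroupOf Y.DeltaTemp : Subgroup Y.DeltaTemp) : Set Y.DeltaTemp) := by
  constructor
  · intro h H
    obtain ⟨H', hH'⟩ := h H
    exact E.isOpen_of_coFreeKernel_cofinal_left hmin H hH'
  · intro h H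
    exact E.coFreeKernel_cofinal_left_of_isOpen hΔ H (h H)

/-- **Node (iii) AT THE CONSTRUCTION with conj. 1 replaced by the openness clause**: both clauses of
[AbsTopI] Prop 4.10 (iii) over {(CF_Δ), OPEN traces, tfg `Δ^tp_X`, `dX`, `dY`, `hmin`}.
[cite: MochizukiAbsTopI2012, Prop 4.10 (iii) p.60] -/
theorem prop410iiiAt_of_isOpen_traces
    (hΔ : ∀ N : OpenNormalSubgroup Y.DeltaTemp, ∃ H' : CharOpenSubgroup Y.DeltaTemp,
      (cofreeCore H'.toSubgroup).subgroupOf Y.DeltaTemp ≤ N.toSubgroup)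
    (hopen : ∀ H : CharOpenSubgroup X.DeltaTemp,
      IsOpen ((((coFreeKernel (E.fHat.comp X.toHat) H.toSubgroup).comap
        Y.toHat.toMonoidHom).subgroupOf Y.DeltaTemp : Subgroup Y.DeltaTemp) : Set Y.DeltaTemp))
    (htfg : IsTopologicallyFinitelyGenerated X.DeltaTemp)
    (dX : X.GroupLevelData) (dY : Y.GroupLevelData)
    (hmin : ∀ H' : CharOpenSubgroup Y.DeltaTemp, ∃ M, IsMinimalCofreeIn H'.toSubgroup M) :
    Prop410iiiAt E ∧ Prop410iiiDeltaAt E :=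
  ⟨prop410iiiAt_of_geometric_residues E hΔ
      (fun H => E.coFreeKernel_cofinal_left_of_isOpen hΔ H (hopen H)) htfg dX dY hmin,
    prop410iiiDeltaAt_of_geometric_residues E hΔ
      (fun H => E.coFreeKernel_cofinal_left_of_isOpen hΔ H (hopen H)) htfg dX dY hmin⟩

end DeCuspidalization

end Literature.AnabelianGeometry.AbsoluteAnabelian.AbsTopI.Prop410

end
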